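import Mathlib
import Literature.NumberTheory.Sieve.ParityBatemanHorn
import Literature.NumberTheory.Sieve.BatemanHornProofs
import Summits.Parity.BatemanHorn.Theses.VanishingDimension
import Summits.Parity.BatemanHorn.Theorems.IsogenyRedeiLambdaToCount
import Summits.Parity.BatemanHorn.Theorems.VanishingDimensionPrimeCellExtractionAux
import Summits.Parity.BatemanHorn.Theorems.AlmostPrimeZerosExtractionAtZeroAux
import HarnessLib

/-!
# Route VanishingDimension — support `PrimeCellExtraction` (item stmt-Parity-18607)

We prove the route statement
`Summit.Parity.BatemanHorn.Theses.VanishingDimension.PrimeCellExtraction`: for a Bateman–Horn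
system `f = (f₁, …, f_k)` and a level exponent `θ ∈ (0, 1/4]`, IF the sifted tilted mass
`Σ_{n ∈ R(x)} w_z(n)` (with `w_z(n) = z^{Σᵢ ω(fᵢ(n))}`, `R(x)` the `n ≤ x` all of whose values
`fᵢ(n)` are free of primes `< ⌊x^θ⌋`) is `A₁(x) V(x) (1 ± ε)` for all small tilts `z` (eventually
in `x`), IF the calibration `(log x)^k A₁ V / (z^k x) → C(f)/∏ deg fᵢ` holds in the same sense, and
IF `#R(x) ≤ C x/(log x)^k`, THEN `BatemanHornAsymptotic f`.

Proof. For `n ≥ n₀(f)` every `fᵢ(n) ≥ 2`, so `w_z(n) ≤ z^k`; on the prime cell (all `fᵢ(n)`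
prime) `w_z(n) = z^k` exactly; if `n` is neither in the prime cell nor has a proper prime-power
coordinate `fᵢ(n) = p^a` (`a ≥ 2`), some coordinate has `ω ≥ 2` and `w_z(n) ≤ z^{k+1}`. The
proper prime-power coordinates number `≪ x^{7/8}`
(`LambdaToCount.card_filter_bad_le`, Bombieri–Pila, proved in the tree), and prime tuples outside
`R(x)` have some `fᵢ(n)` equal to a prime `< x^θ`, so they number `≤ (Σ deg fᵢ) x^θ`. Hence
`z^k (π_f(x) − O(x^{1/4})) ≤ Σ_R w_z ≤ n₀ + z^k (π_f(x) + K x^{7/8}) + z^{k+1} C x/(log x)^k`,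
and the sandwich + calibration give, for every `η > 0`, a fixed small `z` with
`|π_f(x) − c x/(log x)^k| ≤ η c x/(log x)^k` eventually (`c = C(f)/∏ deg fᵢ`), i.e.
`π_f(x) ~ c x/(log x)^k`; `HasBatemanHornConst f C(f)` is the proved
`IsBatemanHornSystem.hasBatemanHornConst_holds`.
-/

open Finset Filter Asymptotics Polynomial ArithmeticFunction
open scoped Classical Topology ArithmeticFunction.omega

namespace Summit.Parity.BatemanHorn.Theorems.PrimeCellExtraction

open Literature.NumberTheory.Sieve

/-! ### The main theorem -/

/-- **`PrimeCellExtraction` (stmt-Parity-18607).** For a Bateman–Horn system `f` and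
`θ ∈ (0, 1/4]`: the sandwich for the sifted tilted mass (for every `ε`, all small tilts `z`,
eventually in `x`), the calibration of the tilted mass at `θ`, and the rough-tuple bound
`#R(x) ≤ C x/(log x)^k` together imply `BatemanHornAsymptotic f`. -/
theorem primeCellExtraction_proof :
    Summit.Parity.BatemanHorn.Theses.VanishingDimension.PrimeCellExtraction := by
  intro k f hf θ hθ hθ' w cnt m V R h1 h2 h3
  obtain ⟨hBH, hCpos⟩ := IsBatemanHornSystem.hasBatemanHornConst_holds hf
  obtain ⟨K, hK⟩ := LambdaToCount.card_filter_bad_le hf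
  obtain ⟨N₀, hN₀⟩ := AlmostPrimeZerosExtraction.exists_forall_two_le_eval hf
  obtain ⟨C, hC⟩ := h3
  set Cf := batemanHornConst f with hCf
  set D : ℝ := ∏ i, ((f i).natDegree : ℝ) with hD
  have hD0 : 0 < D := prod_pos fun i _ => by exact_mod_cast hf.natDegree_pos i
  set Sdeg : ℕ := ∑ i, (f i).natDegree with hSdeg
  set good : ℕ → Prop := fun n => ∀ i, 0 < (f i).eval (n : ℤ) ∧ (((f i).eval (n : ℤ)).toNat).Prime
    with hgood_def
  set bad : ℕ → Prop := fun n => ∃ i, ∃ p a : ℕ, p.Prime ∧ 2 ≤ a ∧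
    ((f i).eval (n : ℤ)).toNat = p ^ a with hbad_def
  have hw : ∀ z n, w z n = z ^ (∑ i, ω (((f i).eval (n : ℤ)).toNat)) := fun _ _ => rfl
  have hR : ∀ x, R x = (Icc 1 x).filter (fun n : ℕ => ∀ i, ∀ p ∈ range ⌊(x : ℝ) ^ θ⌋₊,
      p.Prime → ¬ ((p : ℤ) ∣ (f i).eval (n : ℤ))) := fun _ => rfl
  have hRsub : ∀ x, R x ⊆ Icc 1 x := fun x => by rw [hR]; exact filter_subset _ _
  -- `polyPrimeCount` versus the count over `1 ≤ n ≤ x`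
  have hPQ : ∀ x : ℕ, (#((Icc 1 x).filter good) : ℝ) ≤ polyPrimeCount f x ∧
      (polyPrimeCount f x : ℝ) ≤ #((Icc 1 x).filter good) + 1 := by
    intro x
    have hP : polyPrimeCount f x = #((range (x + 1)).filter good) := by
      unfold polyPrimeCount
      convert rfl
    have h1' : #((Icc 1 x).filter good) ≤ #((range (x + 1)).filter good) := by
      refine card_le_card fun n hn => ?_
      rw [mem_filter, mem_Icc] at hn
      exact mem_filter.mpr ⟨mem_range.mpr (by omega), hn.2⟩
    have h2' : #((range (x + 1)).filter good) ≤ #((Icc 1 x).filter good) + 1 := by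
      refine (card_le_card fun n hn => ?_).trans (card_insert_le 0 _)
      rw [mem_filter, mem_range] at hn
      rw [mem_insert, mem_filter, mem_Icc]
      rcases Nat.eq_zero_or_pos n with h | h
      · exact Or.inl h
      · exact Or.inr ⟨⟨h, by omega⟩, hn.2⟩
    rw [hP]
    exact ⟨by exact_mod_cast h1', by exact_mod_cast h2'⟩
  refine ⟨Cf, hBH, ?_⟩
  have hmain := extraction (k := k) (c := Cf / D) (C := C) (N₀ := (N₀ : ℝ)) (div_pos hCpos hD0)
    (P := fun x => (polyPrimeCount f x : ℝ))
    (E₁ := fun x => 1 + (Sdeg : ℝ) * (⌊(x : ℝ) ^ θ⌋₊ : ℕ))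
    (E₂ := fun x => K * (x : ℝ) ^ (7 / 8 : ℝ))
    (S := fun z x => ∑ n ∈ R x, w z n) (A := fun z x => ∑ n ∈ Icc 1 x, w z n) (V := V)
    h1 h2 ?hlo ?hup ?hE₁ ?hE₂
  · simp only [Fintype.card_fin]
    refine hmain.congr_right (Eventually.of_forall fun x => ?_)
    simp only [hD]
    ring
  case hlo =>
    intro z hz0 hz1
    refine Eventually.of_forall fun x => ?_
    set y := ⌊(x : ℝ) ^ θ⌋₊ with hy
    -- the prime cell inside `R x` carries weight exactly `z^k`
    have hcell : z ^ k * (#((R x).filter good) : ℝ) ≤ ∑ n ∈ R x, w z n := by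
      have hval : ∀ n ∈ (R x).filter good, w z n = z ^ k := fun n hn => by
        rw [hw, sum_cardDistinctFactors_eq_of_prime fun i => ((mem_filter.mp hn).2 i).2]
      calc z ^ k * (#((R x).filter good) : ℝ) = ∑ n ∈ (R x).filter good, w z n := by
            rw [sum_congr rfl hval, sum_const, nsmul_eq_mul, mul_comm]
        _ ≤ ∑ n ∈ R x, w z n :=
            sum_le_sum_of_subset_of_nonneg (filter_subset _ _) fun n _ _ => by
              rw [hw]
              positivity
    -- prime tuples outside `R x` have a prime coordinate `< y`
    have hcount : #((Icc 1 x).filter good) ≤ #((R x).filter good) + y * Sdeg := by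
      have hsub : (Icc 1 x).filter good ⊆ (R x).filter good ∪
          (Icc 1 x).filter (fun n : ℕ =>
            (∀ i, 0 < (f i).eval (n : ℤ) ∧ (((f i).eval (n : ℤ)).toNat).Prime) ∧
              ∃ i, ∃ p ∈ range y, p.Prime ∧ (p : ℤ) ∣ (f i).eval (n : ℤ)) := by
        intro n hn
        rw [mem_filter] at hn
        rw [mem_union]
        by_cases hnR : n ∈ R x
        · exact Or.inl (mem_filter.mpr ⟨hnR, hn.2⟩)
        · refine Or.inr (mem_filter.mpr ⟨hn.1, hn.2, ?_⟩)
          rw [hR, mem_filter, not_and] at hnR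
          have := hnR hn.1
          push Not at this
          obtain ⟨i, p, hp, hpp, hdvd⟩ := this
          exact ⟨i, p, hp, hpp, hdvd⟩
      calc #((Icc 1 x).filter good)
          ≤ #((R x).filter good ∪ (Icc 1 x).filter (fun n : ℕ =>
              (∀ i, 0 < (f i).eval (n : ℤ) ∧ (((f i).eval (n : ℤ)).toNat).Prime) ∧
                ∃ i, ∃ p ∈ range y, p.Prime ∧ (p : ℤ) ∣ (f i).eval (n : ℤ))) := card_le_card hsub
        _ ≤ #((R x).filter good) + #((Icc 1 x).filter (fun n : ℕ =>
              (∀ i, 0 < (f i).eval (n : ℤ) ∧ (((f i).eval (n : ℤ)).toNat).Prime) ∧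
                ∃ i, ∃ p ∈ range y, p.Prime ∧ (p : ℤ) ∣ (f i).eval (n : ℤ))) := card_union_le _ _
        _ ≤ #((R x).filter good) + y * Sdeg :=
            Nat.add_le_add_left (card_filter_good_dvd_le f hf.natDegree_pos x y) _
    have hcount' : (#((Icc 1 x).filter good) : ℝ) ≤ #((R x).filter good) + (y : ℝ) * Sdeg := by
      exact_mod_cast hcount
    have hP2 := (hPQ x).2
    have hzk : 0 ≤ z ^ k := pow_nonneg hz0.le k
    calc z ^ k * ((polyPrimeCount f x : ℝ) - (1 + (Sdeg : ℝ) * (y : ℝ)))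
        ≤ z ^ k * (#((R x).filter good) : ℝ) := by
          refine mul_le_mul_of_nonneg_left ?_ hzk
          linarith [mul_comm (Sdeg : ℝ) (y : ℝ)]
      _ ≤ ∑ n ∈ R x, w z n := hcell
  case hup =>
    intro z hz0 hz1
    filter_upwards [hC, eventually_ge_atTop 1] with x hCx hx1
    have hzk : 0 ≤ z ^ k := pow_nonneg hz0.le k
    have hzk1 : 0 ≤ z ^ (k + 1) := pow_nonneg hz0.le (k + 1)
    -- pointwise bound on the weights
    have hpt : ∀ n ∈ R x, w z n ≤ (if n < N₀ then (1 : ℝ) else 0) +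
        z ^ k * (if good n then (1 : ℝ) else 0) + z ^ k * (if bad n then (1 : ℝ) else 0) +
          z ^ (k + 1) := by
      intro n _
      by_cases hlt : n < N₀
      · rw [if_pos hlt]
        have hle : w z n ≤ 1 := by
          rw [hw]
          exact pow_le_one₀ hz0.le hz1
        have ha : 0 ≤ z ^ k * (if good n then (1 : ℝ) else 0) := by positivity
        have hb : 0 ≤ z ^ k * (if bad n then (1 : ℝ) else 0) := by positivity
        linarith
      · rw [if_neg hlt]
        push Not at hlt
        have h2le : ∀ i, 2 ≤ (((f i).eval (n : ℤ)).toNat : ℕ) := fun i =>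
          Int.lt_toNat.mpr (by have := hN₀ n hlt i; omega)
        by_cases hg : good n
        · rw [if_pos hg]
          have hval : w z n = z ^ k := by
            rw [hw, sum_cardDistinctFactors_eq_of_prime fun i => (hg i).2]
          have hb : 0 ≤ z ^ k * (if bad n then (1 : ℝ) else 0) := by positivity
          linarith
        · rw [if_neg hg]
          by_cases hb : bad n
          · rw [if_pos hb]
            have hle : w z n ≤ z ^ k := by
              rw [hw]
              exact pow_le_pow_of_le_one hz0.le hz1 (le_sum_cardDistinctFactors h2le)
            linarith
          · rw [if_neg hb]
            -- neither a prime tuple nor a proper prime power somewhere: `Σ ω ≥ k + 1`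
            have hng : ∃ i, ¬(((f i).eval (n : ℤ)).toNat).Prime := by
              by_contra hall
              push Not at hall
              exact hg fun i => ⟨by have := hN₀ n hlt i; omega, hall i⟩
            obtain ⟨i₀, hi₀⟩ := hng
            have hnpow : ∀ p a : ℕ, p.Prime → 2 ≤ a → ((f i₀).eval (n : ℤ)).toNat ≠ p ^ a :=
              fun p a hp ha heq => hb ⟨i₀, p, a, hp, ha, heq⟩
            have hω : 2 ≤ ω (((f i₀).eval (n : ℤ)).toNat) :=
              two_le_cardDistinctFactors (h2le i₀) hi₀ hnpow
            have hle : w z n ≤ z ^ (k + 1) := by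
              rw [hw]
              exact pow_le_pow_of_le_one hz0.le hz1 (succ_le_sum_cardDistinctFactors h2le hω)
            linarith
    -- summing the pointwise bound
    have hsum : ∑ n ∈ R x, w z n ≤ (#((R x).filter fun n => n < N₀) : ℝ) +
        z ^ k * #((R x).filter good) + z ^ k * #((R x).filter bad) + z ^ (k + 1) * #(R x) := by
      refine (sum_le_sum hpt).trans (le_of_eq ?_)
      rw [sum_add_distrib, sum_add_distrib, sum_add_distrib, ← mul_sum, ← mul_sum, sum_boole,
        sum_boole, sum_boole, sum_const, nsmul_eq_mul, mul_comm (#(R x) : ℝ)]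
    -- the four counts
    have hc1 : (#((R x).filter fun n => n < N₀) : ℝ) ≤ N₀ := by
      have : #((R x).filter fun n => n < N₀) ≤ N₀ :=
        calc #((R x).filter fun n => n < N₀) ≤ #(range N₀) :=
              card_le_card fun n hn => mem_range.mpr (mem_filter.mp hn).2
          _ = N₀ := card_range N₀
      exact_mod_cast this
    have hc2 : (#((R x).filter good) : ℝ) ≤ polyPrimeCount f x := by
      refine le_trans ?_ (hPQ x).1
      exact_mod_cast card_le_card (filter_subset_filter _ (hRsub x))
    have hc3 : (#((R x).filter bad) : ℝ) ≤ K * (x : ℝ) ^ (7 / 8 : ℝ) := by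
      refine le_trans ?_ (hK x hx1)
      exact_mod_cast card_le_card (filter_subset_filter _ (hRsub x))
    have hc4 : (#(R x) : ℝ) ≤ C * (x : ℝ) / Real.log x ^ k := hCx
    calc ∑ n ∈ R x, w z n
        ≤ (#((R x).filter fun n => n < N₀) : ℝ) + z ^ k * #((R x).filter good) +
            z ^ k * #((R x).filter bad) + z ^ (k + 1) * #(R x) := hsum
      _ ≤ (N₀ : ℝ) + z ^ k * polyPrimeCount f x + z ^ k * (K * (x : ℝ) ^ (7 / 8 : ℝ)) +
            z ^ (k + 1) * (C * (x : ℝ) / Real.log x ^ k) := by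
          gcongr
      _ = (N₀ : ℝ) + z ^ k * ((polyPrimeCount f x : ℝ) + K * (x : ℝ) ^ (7 / 8 : ℝ)) +
            z ^ (k + 1) * C * ((x : ℝ) / Real.log x ^ k) := by ring
  case hE₁ =>
    have hbig : (fun x : ℕ => 1 + (Sdeg : ℝ) * (⌊(x : ℝ) ^ θ⌋₊ : ℕ)) =O[atTop]
        fun x : ℕ => (x : ℝ) ^ (1 / 4 : ℝ) := by
      refine IsBigO.of_bound (1 + (Sdeg : ℝ)) ?_
      filter_upwards [eventually_ge_atTop 1] with x hx1
      have hx1' : (1 : ℝ) ≤ x := by exact_mod_cast hx1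
      have hx0 : (0 : ℝ) ≤ x := by positivity
      have hq : (1 : ℝ) ≤ (x : ℝ) ^ (1 / 4 : ℝ) := Real.one_le_rpow hx1' (by norm_num)
      have hfloor : ((⌊(x : ℝ) ^ θ⌋₊ : ℕ) : ℝ) ≤ (x : ℝ) ^ (1 / 4 : ℝ) :=
        (Nat.floor_le (Real.rpow_nonneg hx0 θ)).trans
          (Real.rpow_le_rpow_of_exponent_le hx1' hθ')
      have hS0 : (0 : ℝ) ≤ Sdeg := Nat.cast_nonneg _
      rw [Real.norm_of_nonneg (by positivity), Real.norm_of_nonneg (by positivity)]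
      nlinarith
    exact hbig.trans_isLittleO (isLittleO_rpow_div_log_pow (by norm_num) k)
  case hE₂ =>
    exact (isLittleO_rpow_div_log_pow (by norm_num : (7 / 8 : ℝ) < 1) k).const_mul_left K

end Summit.Parity.BatemanHorn.Theorems.PrimeCellExtraction
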